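import Literature.NumberTheory.LFunctions.RHWave0
import HarnessLib

/-!
# The explicit classical zero-free region (Mossinghoff–Trudgian–Yang 2024, Thm. 1.3): reduction

Topic `Literature/NumberTheory/LFunctions`; sibling of `RHWave0.lean`, which vendors the named fact
`Literature.NumberTheory.LFunctions.zero_free_region_mossinghoff_trudgian_yang` (rh.S09, explicit form):

> `ζ(σ + it) ≠ 0` for `|t| ≥ 2` and `σ ≥ 1 − 1/(5.558691 log|t|)`
> (Mossinghoff–Trudgian–Yang, *Res. Number Theory* 10 (2024), **Theorem 1.3** — arXiv numbering;
> the locator "Theorem 1" in `RHWave0` is loose: Thm. 1.1 there is the Vinogradov–Korobov region).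

## Architecture of the printed proof (MTY 2024, §9, pp. 17–18 of arXiv:2212.06867v3)

By `ζ(s̄) = conj ζ(s)` only `t > 0` matters (op. cit. §4, "it suffices to consider only `t > 0`
throughout"). The proof then has exactly two ingredients, split at the height
`T₀ = H = 3·10¹²` up to which the Riemann hypothesis has been verified:

* **(A) `2 ≤ t ≤ T₀` — a certified computation.** Platt–Trudgian (*Bull. LMS* 53 (2021), Thm. 1)
  verified that every zero `β + iγ` with `0 < γ ≤ 3 000 175 332 800` has `β = 1/2`; and
  `1/2 < 1 − 1/(5.558691 log t)` as soon as `5.558691 log t > 2`, in particular for `t ≥ 2`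
  (`5.558691 · log 2 > 3.85`). This is the in-tree named fact `Literature.NumberTheory.LFunctions.platt_trudgian_numerical_rh`
  (rh.S35).
* **(B) `t > T₀` — the analytic core.** Kadiri's iterative method (*Acta Arith.* 117 (2005),
  Théorème 1.1: `R₀ = 5.69693` as published, `5.70176` in arXiv:math/0401238), as sharpened by
  Mossinghoff–Trudgian (*J. Number Theory* 157 (2015), Thm. 1: a degree-16 non-negative
  trigonometric polynomial found by simulated annealing and an optimised error term, `T₀ =
  3.06·10¹⁰`, `R₀ = 5.573412`), run with the Heath-Brown/Jang–Kwon smoothing function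
  `h^{(1)}_{1,θ}`, `λ = 1`, `θ = 1.13489`, and the new height `T₀ = 3·10¹²`: seven iterations give
  `R₀ = 5.5586904517`, hence Theorem 1.3 with the rounded constant `5.558691` (MTY 2024, §9 and its
  table of iterates). The inputs of the method (Mossinghoff–Trudgian 2015, §2) are: a height `T₀`
  to which RH has been verified — here (A); a constant `R` "for which the classical zero-free
  region has already been established" — here the initial upper bound `R = 5.573412`, i.e.
  Theorem 1 of Mossinghoff–Trudgian 2015 (ingredient **(B₀)**, see below); a target `r < R` (`r = 5`);
  and the polynomial and kernel above. A hypothetical zero `β₀ + iγ₀` with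
  `1 − 1/(r log γ₀) ≤ β₀ ≤ 1 − 1/(R log γ₀)` has `γ₀ > T₀` by (A), and the master inequality
  `R₀ ≤ A g₁(θ)(1 − κ)/(2(K(w, θ) − C(η)))` (op. cit. (2.2), refined as (3.1)) with its explicit
  error term `C(η) ≤ 0` pushes it to `β₀ ≤ 1 − 1/(R₀ log γ₀)`; MTY verify numerically that
  `C(η) ≤ 0` on `[0, 1/(5 log(3·10¹²))]` and that `K(w)` is increasing on `[0, 1]` for their kernel.

(A) is not within reach of the kernel: it is a large certified interval-arithmetic computation
(`1.2·10¹³` zeros; `RHWave0NumericalRHProofs.lean` reduces it to a count-form fact, nothing more),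
and it cannot be traded for analysis, since the constant the method yields from a lower verified
height is larger (`R₀ ≈ 5.4912 + 2.0185/log T₀`, Mossinghoff–Trudgian 2015, §6.1). (B) is Kadiri
2005 (37 pp.) plus Mossinghoff–Trudgian 2015 (21 pp.) of explicit analytic number theory (explicit
Stirling/digamma bounds, the smoothed explicit formula with Heath-Brown kernels, positivity of the
kernel's Laplace transform, the trigonometric-polynomial inequality) ending in a certified numerical
iteration — and HAS SINCE BEEN PROVED in the tree from (A) alone (status 2026-08-15): the engine
`KadiriStrip.strip_empty` (`KadiriStripEmptiness.lean`) and four certified rounds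
`7062 → 6.4 → 5.66 → 5.57 → 5.558691` at `T₀ = 3·10¹²` (`KadiriNumericsFinal.lean`:
`zero_free_region_mossinghoff_trudgian_yang_large_height_of_numerical_rh`;
`ExplicitZeroFreeRegionRoundsProofs.lean`: `zero_free_region_mossinghoff_trudgian_yang_of_numerical_rh_only`),
so Theorem 1.3 is now conditional on the computational leaf (A) only. By contrast the
INEXPLICIT region rh.S09 (`Literature.NumberTheory.LFunctions.zero_free_region_classical`: some absolute `c > 0`) is a theorem
in the tree: the abstract de la Vallée-Poussin–Landau argument `Literature.NumberTheory.LFunctions.ClassicalZFRData.zeroFree`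
(`ClassicalZeroFreeRegion.lean`, Montgomery–Vaughan Theorem 6.6 via Titchmarsh's Lemma α)
specialised to `ζ` (`ZetaZeroFreeRegion.lean`, `Literature.NumberTheory.LFunctions.zero_free_region_classical_holds`); the
constant that local method yields is hopelessly small compared with `1/5.558691`, which is why the
explicit theorem needs the global (Kadiri) method and the numerical input (A). Accordingly this file

* vendors **(B)** as its own named fact `zero_free_region_mossinghoff_trudgian_yang_large_height`
  (a `def … : Prop`, stated for `t > 3·10¹²`, i.e. literally the restriction of Thm. 1.3 to the
  heights not covered by (A));
* records its input **(B₀)**, Theorem 1 of Mossinghoff–Trudgian 2015 (`R₀ = 5.573412`: "There are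
  no zeros of `ζ(σ + it)` for `|t| ≥ 2` and `σ > 1 − 1/(5.573412 log|t|)`"), ONLY through the
  PROVED remark that it is a corollary of Thm. 1.3 (`5.558691 ≤ 5.573412`,
  `zero_free_region_mossinghoff_trudgian_2015_of_mossinghoff_trudgian_yang`, statement spelled out)
  — **not as a named fact** (D-0026 review of this decomposition, 2026-08-15): (B₀) is proved in
  the tree from (A) alone (`zero_free_region_mossinghoff_trudgian_2015_of_numerical_rh`,
  `ExplicitZeroFreeRegionRoundsProofs.lean`; open-region spelling `HasOpenClassicalZeroFreeRegion
  5.573412`, `ExplicitZeroFreeRegionKernel.lean`), it is implied by Thm. 1.3, every proof of it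
  passes through (A) exactly as Thm. 1.3 does, and it is not an input of the proved glue
  (A) + (B) ⇒ Thm. 1.3 below — so as a separate `Prop`-valued definition it carried no trust
  content of its own (the same ruling as for Kadiri's region (B₁) `5.69693`,
  `ExplicitZeroFreeRegionInputs.lean`);
* PROVES the assembly `zero_free_region_mossinghoff_trudgian_yang_of_numerical_rh :
  platt_trudgian_numerical_rh → …_large_height → zero_free_region_mossinghoff_trudgian_yang`
  (conjugation symmetry and the inequality `1 − 1/(5.558691 log|t|) > 1/2` for `|t| ≥ 2`, from
  `Real.log_two_gt_d9`, which makes (A) contradict a zero of height `≤ 3·10¹²` in the region);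
* PROVES the converse bookkeeping `…_large_height_of` (so (B) is exactly the residual content of
  Thm. 1.3 given (A)) and the corollary `zero_free_region_classical_of_mossinghoff_trudgian_yang`:
  Thm. 1.3 gives the de la Vallée Poussin region `rh.S09` (`zero_free_region_classical`) with the
  explicit witness `c = 1/5.558691`.

So `zero_free_region_mossinghoff_trudgian_yang` holds in-tree as soon as the two leaves (A), (B)
are fed — and, (B) being proved from (A), as soon as (A) is; users needing the explicit region
should keep taking `(h : zero_free_region_mossinghoff_trudgian_yang)` (or
`(hA : platt_trudgian_numerical_rh)`, via `zero_free_region_mossinghoff_trudgian_yang_of_numerical_rh_only`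
of `ExplicitZeroFreeRegionRoundsProofs.lean`), while users content with SOME constant should use
the proved `Literature.NumberTheory.LFunctions.zero_free_region_classical_holds`.

## References

* M. J. Mossinghoff, T. S. Trudgian, A. Yang, *Explicit zero-free regions for the Riemann
  zeta-function*, Res. Number Theory 10 (2024), no. 11 (arXiv:2212.06867), Thm. 1.3 and §9.
* D. Platt, T. Trudgian, *The Riemann hypothesis is true up to 3·10¹²*, Bull. Lond. Math. Soc. 53
  (2021), 792–797, Thm. 1.
* H. Kadiri, *Une région explicite sans zéros pour la fonction ζ de Riemann*, Acta Arith. 117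
  (2005), 303–339, Thm. 1.1.
* M. J. Mossinghoff, T. S. Trudgian, *Nonnegative trigonometric polynomials and a zero-free region
  for the Riemann zeta-function*, J. Number Theory 157 (2015), 329–349 (arXiv:1410.3926), Thm. 1,
  §2 (Kadiri's method, master inequality (2.2)) and §3 ((3.1), seven rounds, `R₀ = 5.5734118005`).
-/

noncomputable section

open Complex

namespace Literature.NumberTheory.LFunctions

/-! ## Leaf (B): the analytic core above the RH-verification height -/

/-- NAMED FACT (Mossinghoff–Trudgian–Yang 2024, Theorem 1.3 restricted to `t > T₀ = 3·10¹²`; the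
range whose printed proof is the Kadiri–Mossinghoff–Trudgian iteration of §9 rather than the
numerical verification of RH). For real `t > 3·10¹²` and `σ ≥ 1 − 1/(5.558691 log t)`,
`ζ(σ + it) ≠ 0`. The printed argument (§9): the degree-16 non-negative trigonometric polynomial
of [MossinghoffTrudgian2015], the smoothing function `h^{(1)}_{1,θ}` with `θ = 1.13489`, and
`T₀ = 3·10¹²`; seven iterations of Kadiri's procedure, started from the already established
region `R = 5.573412` ((B₀), [MossinghoffTrudgian2015] Thm. 1) with target `r = 5`, yield
the admissible constant `R₀ = 5.5586904517 ≤ 5.558691`. Only `t > 0` is stated (conjugation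
symmetry handles `t < 0`, as in the source, §4). Users take
`(h : zero_free_region_mossinghoff_trudgian_yang_large_height)`.
[cite: MossinghoffTrudgianYangRNT2024, Theorem 1.3 and §9]
[cite: Kadiri2005, Théorème 1.1 (the method; R₀ = 5.69693, arXiv version 5.70176)]
[cite: MossinghoffTrudgian2015, Thm 1 (degree-16 polynomial, R₀ = 5.573412)] -/
def zero_free_region_mossinghoff_trudgian_yang_large_height : Prop :=
  ∀ σ t : ℝ, 3 * 10 ^ 12 < t → 1 - 1 / (5.558691 * Real.log t) ≤ σ →
    riemannZeta (σ + t * I) ≠ 0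

/-! ## Elementary lemmas -/

/-- The region of Theorem 1.3 lies strictly to the right of the critical line: for `|t| ≥ 2`,
`1 − 1/(5.558691 log|t|) ≤ σ` forces `1/2 < σ`, because `5.558691 · log|t| ≥ 5.558691 · log 2 > 2`
(`Real.log_two_gt_d9`). This is the (only) inequality linking ingredient (A) to the theorem.
[cite: MossinghoffTrudgianYangRNT2024, §1 (all zeros with |t| ≤ 3·10¹² lie on the critical line)] -/
theorem one_half_lt_of_mossinghoff_trudgian_yang_region {σ t : ℝ} (ht : 2 ≤ |t|)
    (hσ : 1 - 1 / (5.558691 * Real.log |t|) ≤ σ) : 1 / 2 < σ := by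
  have hlog2 : (0.6931471803 : ℝ) < Real.log 2 := Real.log_two_gt_d9
  have hlog : Real.log 2 ≤ Real.log |t| := Real.log_le_log two_pos ht
  have hpos : (2 : ℝ) < 5.558691 * Real.log |t| := by nlinarith
  have hlt : 1 / (5.558691 * Real.log |t|) < 1 / 2 := one_div_lt_one_div_of_lt two_pos hpos
  linarith

/-- Conjugation symmetry of the zeros of `ζ` in the coordinates `σ + it`: from Mathlib's
`riemannZeta_conj`, `ζ(σ − it) = conj ζ(σ + it)` for real `σ, t`. [folklore] -/
theorem riemannZeta_ofReal_add_neg_mul_I (σ t : ℝ) :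
    riemannZeta (σ + (-t : ℝ) * I) = (starRingEnd ℂ) (riemannZeta (σ + t * I)) := by
  rw [← riemannZeta_conj]
  congr 1
  apply Complex.ext <;> simp

/-- A zero `σ + it` of `ζ` gives the zero `σ − it`. [folklore] -/
theorem riemannZeta_eq_zero_neg_im {σ t : ℝ} (h : riemannZeta (σ + t * I) = 0) :
    riemannZeta (σ + (-t : ℝ) * I) = 0 := by
  rw [riemannZeta_ofReal_add_neg_mul_I, h, map_zero]

/-- Reduction to positive height: a property of the zeros of `ζ` phrased through `|t|` holds for
all `|t| ≥ 2` as soon as it holds for all `t ≥ 2` (apply it to `-t` and conjugate). [folklore] -/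
theorem forall_abs_of_forall_pos {P : ℝ → ℝ → Prop}
    (hP : ∀ σ t : ℝ, 2 ≤ t → P σ t → riemannZeta (σ + t * I) ≠ 0) :
    ∀ σ t : ℝ, 2 ≤ |t| → P σ |t| → riemannZeta (σ + t * I) ≠ 0 := by
  intro σ t ht hPt hzero
  rcases le_or_gt 0 t with ht0 | ht0
  · rw [abs_of_nonneg ht0] at ht hPt
    exact hP σ t ht hPt hzero
  · rw [abs_of_neg ht0] at ht hPt
    exact hP σ (-t) ht hPt (riemannZeta_eq_zero_neg_im hzero)

/-! ## Assembly: (A) + (B) ⟹ Theorem 1.3 -/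

/-- Theorem 1.3 of Mossinghoff–Trudgian–Yang for **positive** height from the two leaves:
(A) `platt_trudgian_numerical_rh` (RH verified for `0 < γ ≤ 3 000 175 332 800 ≥ 3·10¹²`) and
(B) `zero_free_region_mossinghoff_trudgian_yang_large_height`. For `2 ≤ t ≤ 3·10¹²` a zero in the
region would have real part `1/2` by (A), contradicting
`one_half_lt_of_mossinghoff_trudgian_yang_region`; for `t > 3·10¹²` the claim is (B) verbatim.
[cite: MossinghoffTrudgianYangRNT2024, Theorem 1.3 and §9] -/
theorem zero_free_region_mossinghoff_trudgian_yang_pos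
    (hA : platt_trudgian_numerical_rh)
    (hB : zero_free_region_mossinghoff_trudgian_yang_large_height)
    (σ t : ℝ) (ht : 2 ≤ t) (hσ : 1 - 1 / (5.558691 * Real.log t) ≤ σ) :
    riemannZeta (σ + t * I) ≠ 0 := by
  intro hzero
  have htabs : |t| = t := abs_of_nonneg (by linarith)
  have hhalf : 1 / 2 < σ :=
    one_half_lt_of_mossinghoff_trudgian_yang_region (t := t) (by rw [htabs]; exact ht)
      (by rw [htabs]; exact hσ)
  rcases lt_or_ge (3 * 10 ^ 12 : ℝ) t with hlarge | hsmall
  · exact hB σ t hlarge hσ hzero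
  · have hre : (σ + t * I : ℂ).re = 1 / 2 :=
      hA (σ + t * I) hzero (by simp; linarith) (by simp; linarith)
    simp at hre
    linarith

/-- **Assembly of rh.S09 (explicit form).** Mossinghoff–Trudgian–Yang 2024, Theorem 1.3 —
`ζ(σ + it) ≠ 0` for `|t| ≥ 2`, `σ ≥ 1 − 1/(5.558691 log|t|)` — from the two leaves of its printed
proof: (A) the Platt–Trudgian numerical verification of RH to height `3·10¹²`
(`platt_trudgian_numerical_rh`, rh.S35) and (B) the analytic core above that height
(`zero_free_region_mossinghoff_trudgian_yang_large_height`). Negative `t` by conjugation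
(`forall_abs_of_forall_pos`). [cite: MossinghoffTrudgianYangRNT2024, Theorem 1.3 and §9]
[cite: PlattTrudgianBLMS2021, Theorem 1] -/
theorem zero_free_region_mossinghoff_trudgian_yang_of_numerical_rh
    (hA : platt_trudgian_numerical_rh)
    (hB : zero_free_region_mossinghoff_trudgian_yang_large_height) :
    zero_free_region_mossinghoff_trudgian_yang :=
  fun σ t ht hσ ↦
    forall_abs_of_forall_pos (P := fun σ t ↦ 1 - 1 / (5.558691 * Real.log t) ≤ σ)
      (fun σ t ht hσ ↦ zero_free_region_mossinghoff_trudgian_yang_pos hA hB σ t ht hσ) σ t ht hσ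

/-- Bookkeeping converse: leaf (B) is a special case of Theorem 1.3, so given (A) the theorem and
(B) are equivalent — (B) is exactly the residual content of Theorem 1.3 not covered by the numerical
verification of RH. [cite: MossinghoffTrudgianYangRNT2024, Theorem 1.3] -/
theorem zero_free_region_mossinghoff_trudgian_yang_large_height_of
    (h : zero_free_region_mossinghoff_trudgian_yang) :
    zero_free_region_mossinghoff_trudgian_yang_large_height := by
  intro σ t ht hσ
  have ht2 : (2 : ℝ) ≤ |t| := by rw [abs_of_nonneg (by linarith)]; linarith
  exact h σ t ht2 (by rwa [abs_of_nonneg (by linarith : (0 : ℝ) ≤ t)])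

/-- Given (A), Theorem 1.3 is equivalent to its analytic core (B).
[cite: MossinghoffTrudgianYangRNT2024, Theorem 1.3 and §9] -/
theorem zero_free_region_mossinghoff_trudgian_yang_iff_large_height
    (hA : platt_trudgian_numerical_rh) :
    zero_free_region_mossinghoff_trudgian_yang ↔
      zero_free_region_mossinghoff_trudgian_yang_large_height :=
  ⟨zero_free_region_mossinghoff_trudgian_yang_large_height_of,
    zero_free_region_mossinghoff_trudgian_yang_of_numerical_rh hA⟩

/-! ## (B₀), Theorem 1 of Mossinghoff–Trudgian 2015, is a corollary of Theorem 1.3 -/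

/-- **(B₀) from Theorem 1.3.** Theorem 1.3 of Mossinghoff–Trudgian–Yang (`R₀ = 5.558691`)
contains Theorem 1 of Mossinghoff–Trudgian 2015, verbatim — "There are no zeros of `ζ(σ + it)`
for `|t| ≥ 2` and `σ > 1 − 1/(5.573412 log|t|)`" (printed proof there: Kadiri's method, op. cit.
§2, with the degree-16 polynomial `F₁₆` of its §§3, 6, `T₀ = 3.06·10¹⁰` (Platt's RH
verification), `t₀ = 10⁵`, `θ = 1.85573`, `r = 5`, initial `R = 5.7`, admissible by Kadiri's
`R₀ = 5.69693`; seven rounds give `R₀ = 5.5734118005`; in the proof of Theorem 1.3 this constant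
is the "initial upper bound `R₀ = 5.573412`" of the iteration, MTY 2024, §9): for `|t| ≥ 2`,
`log|t| > 0` and `1/(5.573412 log|t|) ≤ 1/(5.558691 log|t|)`, so the 2015 region lies inside the
2024 one. The conclusion is the statement of Theorem 1 spelled out (its open-region spelling
`HasOpenClassicalZeroFreeRegion 5.573412` lives in `ExplicitZeroFreeRegionKernel.lean`, its proof
from leaf (A) alone in `ExplicitZeroFreeRegionRoundsProofs.lean`).
[cite: MossinghoffTrudgianYangRNT2024, Theorem 1.3 and §9 (initial upper bound R₀ = 5.573412)]
[cite: MossinghoffTrudgian2015, Theorem 1 and §§2–3] -/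
theorem zero_free_region_mossinghoff_trudgian_2015_of_mossinghoff_trudgian_yang
    (h : zero_free_region_mossinghoff_trudgian_yang) :
    ∀ σ t : ℝ, 2 ≤ |t| → 1 - 1 / (5.573412 * Real.log |t|) < σ → riemannZeta (σ + t * I) ≠ 0 := by
  intro σ t ht hσ
  refine h σ t ht ?_
  have hlog : 0 < Real.log |t| :=
    (Real.log_pos one_lt_two).trans_le (Real.log_le_log two_pos ht)
  have hle : 1 / (5.573412 * Real.log |t|) ≤ 1 / (5.558691 * Real.log |t|) :=
    one_div_le_one_div_of_le (by positivity) (by nlinarith)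
  linarith

/-! ## Corollary: the de la Vallée Poussin region with `c = 1/5.558691` -/

/-- Theorem 1.3 of Mossinghoff–Trudgian–Yang gives the classical zero-free region rh.S09
(`zero_free_region_classical`) with the absolute constant `c = 1/5.558691`:
`1 − c/log|t| = 1 − 1/(5.558691 log|t|)`. [cite: MossinghoffTrudgianYangRNT2024, Theorem 1.3] -/
theorem zero_free_region_classical_of_mossinghoff_trudgian_yang
    (h : zero_free_region_mossinghoff_trudgian_yang) : zero_free_region_classical := by
  refine ⟨1 / 5.558691, by norm_num, fun σ t ht hσ ↦ h σ t ht ?_⟩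
  rwa [← div_div]

/-- rh.S09 (`zero_free_region_classical`, de la Vallée Poussin 1899) from the two leaves (A), (B)
of the Mossinghoff–Trudgian–Yang proof (with the witness `c = 1/5.558691`; unconditionally, with an
inexplicit constant, rh.S09 is `Literature.NumberTheory.LFunctions.zero_free_region_classical_holds` of
`ZetaZeroFreeRegion.lean`). [cite: MossinghoffTrudgianYangRNT2024, Theorem 1.3 and §9]
[cite: PlattTrudgianBLMS2021, Theorem 1] -/
theorem zero_free_region_classical_of_numerical_rh
    (hA : platt_trudgian_numerical_rh)
    (hB : zero_free_region_mossinghoff_trudgian_yang_large_height) : zero_free_region_classical :=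
  zero_free_region_classical_of_mossinghoff_trudgian_yang
    (zero_free_region_mossinghoff_trudgian_yang_of_numerical_rh hA hB)

end Literature.NumberTheory.LFunctions
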